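import Literature.MathematicalPhysics.QuantumFieldTheory.BalabanImbrieJaffe1984to88.BIJ88Ineq5144TwoCube
import Literature.MathematicalPhysics.QuantumFieldTheory.BalabanImbrieJaffe1984to88.BIJ88OneCubeSpareShell309

/-!
# `BalabanImbrieJaffe1984to88.BIJ88Ineq5144TwoCubeChi` — T. Bałaban, J. Imbrie, A. Jaffe, *Effective action and cluster properties of the abelian
Higgs model*, Commun. Math. Phys. **114** (1988) 257–315 [BalabanImbrieJaffe1988], Sect. 5.14 (5.14.4) p. 309 [PDF 53] with Sect. 5.13 p. 307 [PDF 51]: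
**(5.14.4) ON THE TWO-CUBE POLYMERS WITH PRINT'S PER-DERIVATIVE FACTOR FOR THE χ-DERIVATIVES** — the χ-half `hekθ₂ : e_k ≤ θ^{1+β′}/2` of the declared
adjustment of p36 g17 `BIJ88Ineq5144TwoCube.ineq5144_locAct_pair_of_struct` is REMOVED: every `t`-derivative of a χ-factor costs exactly print's factor
(`e_k ≤ θ`, p. 309 *"ct^{−n}e^{−cp(te_k)²} ≦ (e^β(L^kε/ε₀)^{1/4−α})ⁿ"*, in tree `BIJ88GaussFactor309.eK_le_vertex`), and the undecorated cube of a pair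
whose labels include a χ-derivative is paid ONCE by a spare power of the Gaussian shell factor (p. 307, verbatim: *"… and from extremely small factors
when a χ′-factor is replaced by 1"*; p. 309, verbatim: *"the coefficient t in front of V^{(k)}(Y) plus a small power of e_k easily beat the bounds
A^{(k)}, φ^{(k)} ≦ cp(e_k)"*): the regime asks `n₀ + 2 ≤ κ(81/100)c₀²|log e_k⁻¹|^{2p−1}` (one order more than g17, so that `e^{−κ′p(te_k)²} ≤ (te_k)^{n₀+2}`)
and `2e_k ≤ θ^{β′}`.  The V-half `hKθ₂ : K_Y e^{2GK₁} ≤ θ^{1+β′}/2` STAYS: it is forced at model level under every θ-per-letter typing of `V_Y`, `∇V_Y`,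
`∇²V_Y` (kernel witnesses p344699 `BIJ88Ineq5144PairAdjustmentWitness`, p346813 `BIJ88Ineq5144PairGradientWitness`; HOME/GAPS.md G-C2-p36-09 + ADDENDA).

statement-level skeleton of published theorems with citation tags; proofs where landed; nothing here is a claim about the Yang–Mills mass gap

PDF held: `paper:balaban1988-cmp114-bij-abelian-higgs-effective-action` (journal page = PDF page + 256); pp. 307, 309 re-read this generation (text
layer; p. 303 as an image).  p. 309, verbatim: *"Let us drop the prime, and prove that |g₃(H_β, X_β)| ≦ (e^β(L^kε/ε₀)^{1/4−α})^{[|H_β| + β′|X_β∖H_β|]}.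
(5.14.4) … Each t-derivative of a χ-factor in χ′_{Λ₁₂^{(k)},t} gives at least a factor e^β(L^kε/ε₀)^{1/4−α}. … After integration over A^{(k)}, we
obtain factors ct^{−n}e^{−cp(te_k)²} ≦ (e^β(L^kε/ε₀)^{1/4−α})ⁿ."*

WHAT IS PROVED (unit `lit-balaban-p36`, generation 18 of the Phase-2 proof seat p36; SKELETON row **C2.Eq5.14.3-5.14.4** member cell of
`HOME/lit-balaban-r16/ROWS-C2-part2.md`, owner r16; row **C2.Eq5.14.5** member).  Data: the §5.13 model of this lineage (`BIJ88W6PrimeVsupp.actIn`).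
* INPUT BY NAME from the companion `BIJ88OneCubeSpareShell309` (same seat and generation): the one-law estimates with a spare shell power and two
  per-derivative factors — `abs_integral_prod_iteratedDeriv_slotFactor_le_spare` (`|∫ Π dP| ≤ e_k·θ_χ^{n_χ}·θ_V^{n_V}` when a χ-slot is differentiated)
  and `abs_integral_prod_iteratedDeriv_slotFactor_le_of_inr_pow` (`≤ θ_V^{n_V}` otherwise).
* §2 exponent arithmetic (`two_mul_mul_pow_le_rpow`, `two_mul_mul_pow_mul_half_rpow_pow_le`).
* §3 **`ineq5144_locAct_pair_of_struct_chi`** — (5.14.4), LOCATED READING, ON EVERY TWO-CUBE POLYMER FOR ANY COUPLING `Δ ≻ 0`, conclusion verbatim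
  `|locAct (cubeIn ∘ γ) (actIn … t γ) H X₂| ≤ θ^{|H| + β′|X₂ ∖ loc H|}`, hypotheses = those of g17's `ineq5144_locAct_pair_of_struct` EXCEPT: `hreg₂`
  at order `n₀ + 2`; `hekθ : e_k ≤ θ` (print) and `hχβ : 2e_k ≤ θ^{β′}` (one spare shell factor pays the undecorated cube) IN PLACE OF `hekθ₂ : e_k ≤ θ^{1+β′}/2`;
  `hKθ₂` kept.  Proof: `actIn_pair_eq`; `H = ∅` verbatim as g17 (twice the vacuum estimate, `hvac₂`); `H ≠ ∅` with a χ-derivative: twice the spare estimate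
  (`2e_kθ^{n_χ}(θ^{1+β′}/2)^{n_V} ≤ θ^{|H|+β′k}`, `k ≤ 1` undecorated cubes — by `hχβ` if `n_V = 0`, by the V-clause's own `θ^{β′}` if `n_V ≥ 1`);
  `H ≠ ∅` with interaction derivatives only: verbatim as g17 (`two_mul_half_rpow_pow_le`).
* §4 **`two_le_of_three_le_chi`** — in this regime the multi-cube leaf hypothesis `h5144two` of the C2.Eq5.14.5 heads follows from its part on `|X_β| ≥ 3`.
HONEST SCOPE: model-level member theorems for r16's typed leaf `BIJ88Sect5StatementsPart2.Ineq5144` (head typed, owner's call); the MECHANISM paying the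
undecorated cube here (a spare shell power) is NOT print's (the p. 307 join train), only its SIZE bookkeeping is print's (*"extremely small factors"*);
the V-half of the adjustment remains a declared divergence from print's constants (p. 310: *"We allow adjustments in β, α, β′, keeping them small"*),
forced at model level; the decay on `|X_β| ≥ 3` is NOT proved.  0 `sorry`, 0 definitions, 0 `Prop` facts (D-0026); imports `BIJ88Ineq5144TwoCube`
(p36 g17) and `BIJ88OneCubeSpareShell309` (p36 g18); modifies nothing.  NOT summit progress; NOT continuum; NOT Clay.  Cell `lit-balaban` Phase 2, seat p36 gen 18 (owner r16, referee ref-5).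
-/

noncomputable section

open Finset MeasureTheory ProbabilityTheory Matrix
open Literature.MathematicalPhysics.QuantumFieldTheory.BalabanImbrieJaffe1984to88
open BIJ88Sect2Statements (pLog)
open BIJ88Sect5Statements (CutoffProfile cutoff)
open BIJ88SlotMoments308 (slotFactor)
open BIJ88DirichletForms305 (interpForm)
open BIJ88PolymerRep5134 (IsConn corner)
open BIJ88PolymerRep5134Gauss (ext src)
open BIJ88SlotMomentsGauss308 (measurable_ext)
open BIJ88Eq5145CornerModel (slotB slotY regionLaw isProbabilityMeasure_regionLaw)
open BIJ88Eq5145CornerUrsell (cubeIn)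
open BIJ88W6PrimeVsupp (actIn)
open BIJ88W6PrimeVsuppBound (card_filter_cubeIn_le)
open BIJ88Ineq5144Located (locAct locAct_of_loc locAct_of_not_loc)
open BIJ88OneCubeVertexFactors309 (abs_integral_prod_slotFactor_sub_one_le_rpow)
open BIJ88OneCubeSpareShell309 (abs_integral_prod_iteratedDeriv_slotFactor_le_spare abs_integral_prod_iteratedDeriv_slotFactor_le_of_inr_pow)
open BIJ88PairActivity309 (actIn_pair_eq interp_corner_posDef tail_slotField_regionLaw_of_struct src_pair_le)
open BIJ88Ineq5144TwoCube (two_mul_half_rpow_pow_le)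

namespace Literature.MathematicalPhysics.QuantumFieldTheory.BalabanImbrieJaffe1984to88.BIJ88Ineq5144TwoCubeChi

/-! ## §2 Exponent arithmetic -/

/-- `2e_k ≤ θ^{β′}` pays the undecorated cube: `2·(e_kθⁿ) ≤ θ^{n + β′k}` for `k ≤ 1`, `0 < θ ≤ 1`, `0 ≤ β′`.
[cite: BalabanImbrieJaffe1988, (5.14.4) p.309] -/
theorem two_mul_mul_pow_le_rpow {θ β' ek : ℝ} (hθ0 : 0 < θ) (hθ1 : θ ≤ 1) (hβ : 0 ≤ β') (hχβ : 2 * ek ≤ θ ^ β') (n : ℕ) {k : ℕ} (hk : k ≤ 1) :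
    2 * (ek * θ ^ n) ≤ θ ^ ((n : ℝ) + β' * (k : ℝ)) := by
  have hk' : (k : ℝ) ≤ 1 := by exact_mod_cast hk
  have h1 : θ ^ β' ≤ θ ^ (β' * (k : ℝ)) :=
    Real.rpow_le_rpow_of_exponent_ge hθ0 hθ1 (by nlinarith [(k : ℕ).cast_nonneg (α := ℝ)])
  rw [Real.rpow_add hθ0, Real.rpow_natCast]
  calc 2 * (ek * θ ^ n) = θ ^ n * (2 * ek) := by ring
    _ ≤ θ ^ n * θ ^ (β' * (k : ℝ)) := mul_le_mul_of_nonneg_left (hχβ.trans h1) (pow_nonneg hθ0.le _)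

/-- with at least one interaction derivative the V-clause's own `θ^{β′}` pays the undecorated cube: `2·(e_kθ^{a}(θ^{1+β′}/2)^{b}) ≤ θ^{(a+b) + β′k}` for
`1 ≤ b`, `k ≤ 1`, `0 ≤ e_k ≤ 1`, `0 < θ ≤ 1`, `0 ≤ β′`. [cite: BalabanImbrieJaffe1988, (5.14.4) p.309] -/
theorem two_mul_mul_pow_mul_half_rpow_pow_le {θ β' ek : ℝ} (hθ0 : 0 < θ) (hθ1 : θ ≤ 1) (hβ : 0 ≤ β') (hek0 : 0 ≤ ek) (hek1 : ek ≤ 1)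
    (a : ℕ) {b k : ℕ} (hb : 1 ≤ b) (hk : k ≤ 1) :
    2 * (ek * θ ^ a * (θ ^ (1 + β') / 2) ^ b) ≤ θ ^ (((a + b : ℕ) : ℝ) + β' * (k : ℝ)) := by
  have hθp : 0 < θ ^ (1 + β') := Real.rpow_pos_of_pos hθ0 _
  have h2b : (2 : ℝ) ≤ 2 ^ b := by
    calc (2 : ℝ) = 2 ^ 1 := (pow_one _).symm
      _ ≤ 2 ^ b := pow_le_pow_right₀ (by norm_num) hb
  have hk' : (k : ℝ) ≤ 1 := by exact_mod_cast hk
  have hb' : (1 : ℝ) ≤ b := by exact_mod_cast hb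
  have hstep : θ ^ a * (θ ^ (1 + β')) ^ b = θ ^ ((a : ℝ) + (1 + β') * b) := by
    rw [← Real.rpow_natCast θ a, ← Real.rpow_natCast (θ ^ (1 + β')) b, ← Real.rpow_mul hθ0.le, ← Real.rpow_add hθ0]
  have h21 : (2 : ℝ) / 2 ^ b ≤ 1 := (div_le_one (by positivity)).2 h2b
  have hZ0 : 0 ≤ θ ^ a * (θ ^ (1 + β')) ^ b := mul_nonneg (pow_nonneg hθ0.le _) (pow_nonneg hθp.le _)
  calc 2 * (ek * θ ^ a * (θ ^ (1 + β') / 2) ^ b) = (2 / 2 ^ b) * ek * (θ ^ a * (θ ^ (1 + β')) ^ b) := by rw [div_pow]; ring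
    _ ≤ 1 * 1 * (θ ^ a * (θ ^ (1 + β')) ^ b) :=
        mul_le_mul_of_nonneg_right (mul_le_mul h21 hek1 hek0 zero_le_one) hZ0
    _ = θ ^ ((a : ℝ) + (1 + β') * b) := by rw [one_mul, one_mul, hstep]
    _ ≤ θ ^ (((a + b : ℕ) : ℝ) + β' * (k : ℝ)) := Real.rpow_le_rpow_of_exponent_ge hθ0 hθ1 (by push_cast; nlinarith)

/-! ## §3 (5.14.4) on the two-cube polymers, print's factor for the χ-derivatives -/

section TwoCube

variable {α I : Type} [Fintype α] [DecidableEq α] [Fintype I] [DecidableEq I]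
  (blk : α → I) (Δ : Matrix α α ℝ) (ℱ : α → ℝ)
variable (adj : I → I → Prop) [DecidableRel adj]
variable (χ : CutoffProfile) {ι υ : Type*} [DecidableEq ι] [DecidableEq υ]
variable {p ek : ℝ} {B : Finset ι} {Φ : ι → (α → ℝ) → ℝ} {c : ι → ℝ} {Ys : Finset υ} {V : υ → (α → ℝ) → ℝ}
variable (cube : ↥B ⊕ ↥Ys → I)

/-- **(5.14.4) ON THE TWO-CUBE POLYMERS, LOCATED READING, ANY COUPLING `Δ ≻ 0`, PRINT'S FACTOR FOR THE χ-DERIVATIVES** (p. 309: *"|g₃(H_β, X_β)| ≦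
(e^β(L^kε/ε₀)^{1/4−α})^{[|H_β| + β′|X_β∖H_β|]} (5.14.4) … Each t-derivative of a χ-factor … gives at least a factor e^β(L^kε/ε₀)^{1/4−α}"*; p. 307:
*"extremely small factors when a χ′-factor is replaced by 1"*): the statement of g17's `BIJ88Ineq5144TwoCube.ineq5144_locAct_pair_of_struct` with the regime
clause `hreg₂` one order higher (`n₀ + 2 ≤ κ(81/100)c₀²|log e_k⁻¹|^{2p−1}`) and the χ-half of its declared adjustment `e_k ≤ θ^{1+β′}/2` REPLACED by
print's `e_k ≤ θ` together with `2e_k ≤ θ^{β′}` (ONE spare shell power pays the undecorated cube of the pair); the V-half `K_Y e^{2GK₁} ≤ θ^{1+β′}/2` is kept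
(forced at model level: G-C2-p36-09).  CONCLUSION verbatim: `|locAct (cubeIn ∘ γ) (actIn … t γ) H X₂| ≤ θ^{|H| + β′|X₂ ∖ loc H|}` for every corner, region,
`t ∈ (0,1]`, `|L| ≤ n₀`, assignment, label set and two-cube polymer. [cite: BalabanImbrieJaffe1988, (5.14.4) p.309; p.307 (Sect. 5.13)] -/
theorem ineq5144_locAct_pair_of_struct_chi [Fintype ι] [Fintype υ] (hp : 1 / 2 < p) {n₀ : ℕ} {C : ℝ} (hC1 : 1 ≤ C)
    (hC : ∀ i, i ≤ n₀ → ∀ (A : ℝ) ⦃q e t : ℝ⦄, q ≠ 0 → 0 < e → 0 < t → t * e ≤ Real.exp (-1) →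
      |iteratedDeriv i (fun s => cutoff χ (q * pLog p (s * e)) A) t| ≤ C * t ^ (-(i : ℤ)))
    (hΔ : Δ.PosDef) {m : ℝ} (hm : 0 < m) (hΔm : ∀ φ : α → ℝ, m * (φ ⬝ᵥ φ) ≤ φ ⬝ᵥ (Δ *ᵥ φ))
    (hχ : ∀ x, 0 ≤ χ.χ₁ x) {c₀ : ℝ} (hc₀ : 0 < c₀) (hcb : ∀ b ∈ B, c₀ ≤ c b) {Λ : ℝ} (hΛ : 0 < Λ)
    (hmod : ∀ b ∈ B, ∃ ℓ₁ ℓ₂ : (α → ℝ) → ℝ, IsLinearMap ℝ ℓ₁ ∧ IsLinearMap ℝ ℓ₂ ∧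
      ((∀ φ, Φ b φ = ℓ₁ φ) ∨ (∀ φ, Φ b φ = Real.sqrt (ℓ₁ φ ^ 2 + ℓ₂ φ ^ 2))) ∧
      (∀ φ, |ℓ₁ φ| ≤ Λ * Real.sqrt (φ ⬝ᵥ φ)) ∧ (∀ φ, |ℓ₂ φ| ≤ Λ * Real.sqrt (φ ⬝ᵥ φ)))
    {F : ℝ} (hF0 : 0 ≤ F) (hF : ∀ i : I, src blk ℱ {i} ⬝ᵥ src blk ℱ {i} ≤ F ^ 2)
    (hV : ∀ Y ∈ Ys, Measurable (V Y)) {KY : υ → ℝ} (hK : ∀ Y ∈ Ys, ∀ φ, |V Y φ| ≤ KY Y)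
    {K₁ : ℝ} (hK₁0 : 0 ≤ K₁) (hK₁ : ∀ Y ∈ Ys, KY Y ≤ K₁) {G : ℕ} (hG : ∀ i, (univ.filter fun τ : ↥B ⊕ ↥Ys => cube τ = i).card ≤ G)
    (hek : 0 < ek) (hek1 : ek ≤ Real.exp (-1)) {θ β' : ℝ} (hθ0 : 0 < θ) (hθ1 : θ ≤ 1) (hβ : 0 ≤ β')
    (hreg₂ : (n₀ : ℝ) + 2 ≤ m / (8 * Λ ^ 2) * (81 / 100) * c₀ ^ 2 * Real.log ek⁻¹ ^ (2 * p - 1))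
    (hpre₂ : C ^ n₀ * (4 * Real.exp (F ^ 2 / m)) * Real.exp (2 * G * K₁) * ek ≤ 1)
    (hvac₂ : Real.exp (2 * G * K₁) * (2 * G) * (4 * Real.exp (F ^ 2 / m)) * ek + (Real.exp (2 * G * K₁) - 1) ≤ θ ^ (2 * β') / 2)
    (hekθ : ek ≤ θ) (hχβ : 2 * ek ≤ θ ^ β') (hKθ₂ : ∀ Y ∈ Ys, KY Y * Real.exp (2 * G * K₁) ≤ θ ^ (1 + β') / 2)
    (Λc X : Finset I) {t : ℝ} (ht : t ∈ Set.Ioc (0 : ℝ) 1) {L : Type} [Fintype L] [DecidableEq L] (hL : Fintype.card L ≤ n₀)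
    (γ : L → ↥(slotB B Ys cube X) ⊕ ↥(slotY B Ys cube X)) (H : Finset L) (X₂ : Finset I) (hX₂ : X₂.card = 2) :
    |locAct (cubeIn cube X ∘ γ) (actIn blk Δ ℱ adj χ p ek B Φ c Ys V cube Λc X t γ) H X₂| ≤
      θ ^ ((H.card : ℝ) + β' * ((X₂ \ H.image (cubeIn cube X ∘ γ)).card : ℝ)) := by
  obtain ⟨i, j, hij, rfl⟩ := card_eq_two.1 hX₂
  by_cases hloc : ∀ l ∈ H, (cubeIn cube X ∘ γ) l ∈ ({i, j} : Finset I)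
  swap
  · rw [locAct_of_not_loc hloc, abs_zero]
    exact Real.rpow_nonneg hθ0.le _
  rw [locAct_of_loc hloc, actIn_pair_eq blk Δ ℱ adj χ p ek B Φ c Ys V cube Λc X t γ H hij]
  split_ifs with hconn
  swap
  · rw [abs_zero]
    exact Real.rpow_nonneg hθ0.le _
  set Y : Finset I := {i, j} with hY
  have hYc : Y.card = 2 := by rw [hY, card_pair hij]
  have hek1' : ek ≤ 1 := hek1.trans (Real.exp_le_one_iff.mpr (by norm_num))
  -- measurability of the slot fields (linear maps / moduli on a finite-dimensional space)
  have hΦm : ∀ b ∈ B, Measurable (Φ b) := fun b hb => by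
    obtain ⟨ℓ₁, ℓ₂, h₁, h₂, h, -, -⟩ := hmod b hb
    exact (BIJ88GaussShellModulus309.continuous_and_zero_of_mod h₁ h₂ h).1.measurable
  -- the two region laws are probability measures
  have hΔc := interp_corner_posDef blk Δ hΔ Λc
  haveI hP1 : IsProbabilityMeasure (regionLaw blk (interpForm blk Δ (corner ℝ Λc)) ℱ Y Y) :=
    isProbabilityMeasure_regionLaw blk _ ℱ hΔc Y Y
  haveI hP0 : IsProbabilityMeasure (regionLaw blk (interpForm blk Δ (corner ℝ Λc)) ℱ Y ∅) :=
    isProbabilityMeasure_regionLaw blk _ ℱ hΔc Y ∅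
  -- the joint slot family of the two cubes
  set T : Finset (↥(slotB B Ys cube X) ⊕ ↥(slotY B Ys cube X)) := univ.filter (fun τ => cubeIn cube X τ ∈ Y) with hT
  have hcb' : ∀ b ∈ T.toLeft, c₀ ≤ (fun b : ↥B => c b) b.1 := fun b _ => hcb b.1 b.1.2
  have hK' : ∀ Y' ∈ T.toRight, ∀ ω : {x : α // blk x ∈ Y} → ℝ,
      |(fun (Y' : ↥Ys) ω => V Y' (ext blk Y ω)) Y'.1 ω| ≤ (fun Y' : ↥Ys => KY Y') Y'.1 := fun Y' _ ω => hK Y'.1 Y'.1.2 _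
  have hKY0 : ∀ Y' ∈ T.toRight, 0 ≤ (fun Y' : ↥Ys => KY Y') Y'.1 := fun Y' _ => (abs_nonneg _).trans (hK Y'.1 Y'.1.2 0)
  have hΦ' : ∀ b ∈ T.toLeft, Measurable fun ω : {x : α // blk x ∈ Y} → ℝ =>
      (fun (b : ↥B) ω => Φ b (ext blk Y ω)) b.1 ω := fun b _ => (hΦm b.1 b.1.2).comp (measurable_ext blk Y)
  have hV' : ∀ Y' ∈ T.toRight, Measurable fun ω : {x : α // blk x ∈ Y} → ℝ =>
      (fun (Y' : ↥Ys) ω => V Y' (ext blk Y ω)) Y'.1 ω := fun Y' _ => (hV Y'.1 Y'.1.2).comp (measurable_ext blk Y)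
  -- at most `2G` slots on the pair; interaction weight `Σ K_Y ≤ 2G K₁`
  have hTG : T.card ≤ 2 * G := by
    have hsub : T ⊆ univ.filter (fun τ => cubeIn cube X τ = i) ∪ univ.filter (fun τ => cubeIn cube X τ = j) := by
      intro τ hτ
      have hτ' := (mem_filter.1 hτ).2
      rw [hY, mem_insert, mem_singleton] at hτ'
      rcases hτ' with h | h
      · exact mem_union_left _ (mem_filter.2 ⟨mem_univ _, h⟩)
      · exact mem_union_right _ (mem_filter.2 ⟨mem_univ _, h⟩)
    calc T.card ≤ (univ.filter (fun τ => cubeIn cube X τ = i) ∪ univ.filter (fun τ => cubeIn cube X τ = j)).card := card_le_card hsub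
      _ ≤ (univ.filter (fun τ => cubeIn cube X τ = i)).card + (univ.filter (fun τ => cubeIn cube X τ = j)).card := card_union_le _ _
      _ ≤ G + G := Nat.add_le_add ((card_filter_cubeIn_le (cube := cube) X i).trans (hG i))
          ((card_filter_cubeIn_le (cube := cube) X j).trans (hG j))
      _ = 2 * G := by ring
  have hKsum : ∑ Y' ∈ T.toRight, (fun Y' : ↥Ys => KY Y') Y'.1 ≤ 2 * G * K₁ := by
    refine (sum_le_card_nsmul _ _ K₁ fun Y' _ => hK₁ Y'.1 Y'.1.2).trans ?_
    rw [nsmul_eq_mul]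
    have h : ((T.toRight).card : ℝ) ≤ 2 * G := by exact_mod_cast (Finset.card_toRight_le).trans hTG
    exact mul_le_mul_of_nonneg_right h hK₁0
  have hGl : ((T.toLeft).card : ℝ) ≤ 2 * G := by exact_mod_cast (Finset.card_toLeft_le).trans hTG
  -- Gaussian tails of the slot fields under BOTH laws, from structural data (`‖ℱ|_{□_i∪□_j}‖₂² ≤ 2F²`)
  have hFY : src blk ℱ Y ⬝ᵥ src blk ℱ Y ≤ (Real.sqrt 2 * F) ^ 2 := src_pair_le blk ℱ hF hij
  have hA2 : (Real.sqrt 2 * F) ^ 2 / (2 * m) = F ^ 2 / m := by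
    rw [mul_pow, Real.sq_sqrt (by norm_num : (0 : ℝ) ≤ 2)]
    field_simp
  have htail : ∀ Λ' : Finset I, ∀ b ∈ T.toLeft, ∀ a : ℝ, 0 ≤ a →
      (regionLaw blk (interpForm blk Δ (corner ℝ Λc)) ℱ Y Λ').real {ω | a ≤ |(fun (b : ↥B) ω => Φ b (ext blk Y ω)) b.1 ω|} ≤
        4 * Real.exp (F ^ 2 / m) * Real.exp (-(m / (8 * Λ ^ 2) * a ^ 2)) := by
    intro Λ' b _ a ha
    obtain ⟨ℓ₁, ℓ₂, h₁, h₂, h, hΛ₁, hΛ₂⟩ := hmod b.1 b.1.2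
    rw [← hA2]
    exact tail_slotField_regionLaw_of_struct blk Δ ℱ hΔ hm hΔm h₁ h₂ h hΛ hΛ₁ hΛ₂ (by positivity) Y hFY Λc Λ' ha
  by_cases hH0 : H = ∅
  · -- THE VACUUM PAIR `(∅, {i,j})`: verbatim as g17 (twice the p. 307 vacuum mechanism)
    subst hH0
    have hreg1 : (1 : ℝ) ≤ m / (8 * Λ ^ 2) * (81 / 100) * c₀ ^ 2 * Real.log ek⁻¹ ^ (2 * p - 1) :=
      le_trans (by have := Nat.cast_nonneg (α := ℝ) n₀; linarith) hreg₂
    have hvac' : Real.exp (2 * G * K₁) * (2 * G) * (4 * Real.exp (F ^ 2 / m)) * ek + (Real.exp (2 * G * K₁) - 1) ≤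
        (θ ^ (2 * β') / 2) ^ (1 : ℝ) := by rw [Real.rpow_one]; exact hvac₂
    rw [show (((∅ : Finset L).card : ℕ) : ℝ) + β' * (((Y \ (∅ : Finset L).image (cubeIn cube X ∘ γ)).card : ℕ) : ℝ) = 2 * β' by
      rw [card_empty, image_empty, sdiff_empty, hYc]; push_cast; ring]
    simp only [filter_empty, card_empty, iteratedDeriv_zero]
    have h1 := abs_integral_prod_slotFactor_sub_one_le_rpow χ (regionLaw blk (interpForm blk Δ (corner ℝ Λc)) ℱ Y Y) p ek
      (slotB B Ys cube X) (fun b ω => Φ b (ext blk Y ω)) (fun b => c b) (slotY B Ys cube X) (fun Y' ω => V Y' (ext blk Y ω)) hχ hp hek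
      hek1 ht.1 ht.2 T hc₀ hcb' (fun Y' => KY Y') hK' hKsum hΦ' hV' (by positivity) (by positivity) (htail Y) hGl hreg1 hvac'
    have h0 := abs_integral_prod_slotFactor_sub_one_le_rpow χ (regionLaw blk (interpForm blk Δ (corner ℝ Λc)) ℱ Y ∅) p ek
      (slotB B Ys cube X) (fun b ω => Φ b (ext blk Y ω)) (fun b => c b) (slotY B Ys cube X) (fun Y' ω => V Y' (ext blk Y ω)) hχ hp hek
      hek1 ht.1 ht.2 T hc₀ hcb' (fun Y' => KY Y') hK' hKsum hΦ' hV' (by positivity) (by positivity) (htail ∅) hGl hreg1 hvac'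
    rw [Real.rpow_one] at h1 h0
    refine (abs_sub_le _ 1 _).trans ?_
    rw [abs_sub_comm (1 : ℝ)]
    refine (add_le_add h1 h0).trans (le_of_eq ?_)
    ring
  · -- DERIVATIVES LOCATED IN THE PAIR
    have hne : H.Nonempty := nonempty_iff_ne_empty.2 hH0
    have hH : ∀ l ∈ H, cubeIn cube X (γ l) ∈ Y := hloc
    have hsumT : ∑ τ ∈ univ.filter (fun τ => cubeIn cube X τ ∈ Y), (H.filter fun l => γ l = τ).card = H.card :=
      (card_eq_sum_card_fiberwise (f := γ) fun l hl => mem_filter.2 ⟨mem_univ _, hH l hl⟩).symm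
    rw [← hT] at hsumT
    set mτ : ↥(slotB B Ys cube X) ⊕ ↥(slotY B Ys cube X) → ℕ := fun τ => (H.filter fun l => γ l = τ).card with hmτ
    have hk1 : (Y \ H.image (cubeIn cube X ∘ γ)).card ≤ 1 := by
      obtain ⟨l, hl⟩ := hne
      have hlt : (Y \ H.image (cubeIn cube X ∘ γ)).card < Y.card := by
        refine card_lt_card ⟨sdiff_subset, fun hsub => ?_⟩
        have hmem := hsub (hH l hl)
        rw [mem_sdiff] at hmem
        exact hmem.2 (mem_image_of_mem _ hl)
      omega
    have hm_le : ∑ τ ∈ T, mτ τ ≤ n₀ := by rw [hsumT]; exact (card_le_univ H).trans hL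
    have hsplit : ∑ τ ∈ T, mτ τ = (∑ b ∈ T.toLeft, mτ (Sum.inl b)) + ∑ Y' ∈ T.toRight, mτ (Sum.inr Y') :=
      Finset.sum_sum_eq_sum_toLeft_add_sum_toRight T mτ
    have hcardH : H.card = (∑ b ∈ T.toLeft, mτ (Sum.inl b)) + ∑ Y' ∈ T.toRight, mτ (Sum.inr Y') := by rw [← hsplit, hsumT]
    have hKθ' : ∀ Y' ∈ T.toRight, (fun Y' : ↥Ys => KY Y') Y'.1 * Real.exp (2 * G * K₁) ≤ θ ^ (1 + β') / 2 :=
      fun Y' _ => hKθ₂ Y'.1 Y'.1.2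
    by_cases hex : ∃ b₀ ∈ T.toLeft, 1 ≤ mτ (Sum.inl b₀)
    · -- a χ-derivative present: print's factor `θ` per χ-derivative, the V-clause per interaction derivative, one spare `e_k`
      have h1 := abs_integral_prod_iteratedDeriv_slotFactor_le_spare χ (regionLaw blk (interpForm blk Δ (corner ℝ Λc)) ℱ Y Y) p ek
        (slotB B Ys cube X) (fun b ω => Φ b (ext blk Y ω)) (fun b => c b) (slotY B Ys cube X) (fun Y' ω => V Y' (ext blk Y ω)) hC1 hC hp
        hek hek1 ht.1 ht.2 T mτ hm_le hex hc₀ hcb' (fun Y' => KY Y') hK' hKY0 hKsum hΦ' (by positivity) (by positivity) (htail Y) hekθ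
        hreg₂ hpre₂ hKθ'
      have h0 := abs_integral_prod_iteratedDeriv_slotFactor_le_spare χ (regionLaw blk (interpForm blk Δ (corner ℝ Λc)) ℱ Y ∅) p ek
        (slotB B Ys cube X) (fun b ω => Φ b (ext blk Y ω)) (fun b => c b) (slotY B Ys cube X) (fun Y' ω => V Y' (ext blk Y ω)) hC1 hC hp
        hek hek1 ht.1 ht.2 T mτ hm_le hex hc₀ hcb' (fun Y' => KY Y') hK' hKY0 hKsum hΦ' (by positivity) (by positivity) (htail ∅) hekθ
        hreg₂ hpre₂ hKθ'
      refine (abs_sub _ _).trans ((add_le_add h1 h0).trans ?_)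
      rw [← two_mul, hcardH]
      by_cases hV0 : ∑ Y' ∈ T.toRight, mτ (Sum.inr Y') = 0
      · rw [hV0, pow_zero, mul_one, add_zero]
        exact two_mul_mul_pow_le_rpow hθ0 hθ1 hβ hχβ _ hk1
      · exact two_mul_mul_pow_mul_half_rpow_pow_le hθ0 hθ1 hβ hek.le hek1' _ (Nat.one_le_iff_ne_zero.2 hV0) hk1
    · -- only interaction slots differentiated: verbatim as g17
      push Not at hex
      have hm0 : ∀ b ∈ T.toLeft, mτ (Sum.inl b) = 0 := fun b hb => Nat.lt_one_iff.mp (hex b hb)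
      have hχ0 : ∑ b ∈ T.toLeft, mτ (Sum.inl b) = 0 := sum_eq_zero hm0
      have hm1 : 1 ≤ ∑ Y' ∈ T.toRight, mτ (Sum.inr Y') := by
        have h := hne.card_pos
        rw [hcardH, hχ0, zero_add] at h
        exact h
      have h1 := abs_integral_prod_iteratedDeriv_slotFactor_le_of_inr_pow χ (regionLaw blk (interpForm blk Δ (corner ℝ Λc)) ℱ Y Y) p ek
        (slotB B Ys cube X) (fun b ω => Φ b (ext blk Y ω)) (fun b => c b) (slotY B Ys cube X) (fun Y' ω => V Y' (ext blk Y ω)) hek hek1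
        ht.1 ht.2 T mτ hm0 hm1 hc₀ hcb' (fun Y' => KY Y') hK' hKY0 hKsum hKθ'
      have h0 := abs_integral_prod_iteratedDeriv_slotFactor_le_of_inr_pow χ (regionLaw blk (interpForm blk Δ (corner ℝ Λc)) ℱ Y ∅) p ek
        (slotB B Ys cube X) (fun b ω => Φ b (ext blk Y ω)) (fun b => c b) (slotY B Ys cube X) (fun Y' ω => V Y' (ext blk Y ω)) hek hek1
        ht.1 ht.2 T mτ hm0 hm1 hc₀ hcb' (fun Y' => KY Y') hK' hKY0 hKsum hKθ'
      refine (abs_sub _ _).trans ((add_le_add h1 h0).trans ?_)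
      rw [← two_mul, hcardH, hχ0, zero_add]
      exact two_mul_half_rpow_pow_le hθ0 hθ1 hβ hm1 (hk1.trans hm1)

/-! ## §4 The multi-cube part of the located leaf reduced to `|X_β| ≥ 3`, in this regime -/

/-- **`h5144two` FROM ITS PART ON THE POLYMERS WITH AT LEAST THREE CUBES**, in the regime of `ineq5144_locAct_pair_of_struct_chi` (print's factor for the
χ-derivatives; the V-clause adjusted as declared). [cite: BalabanImbrieJaffe1988, (5.14.4) p.309; (5.14.5) p.312] -/
theorem two_le_of_three_le_chi [Fintype ι] [Fintype υ] (hp : 1 / 2 < p) {n₀ : ℕ} {C : ℝ} (hC1 : 1 ≤ C)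
    (hC : ∀ i, i ≤ n₀ → ∀ (A : ℝ) ⦃q e t : ℝ⦄, q ≠ 0 → 0 < e → 0 < t → t * e ≤ Real.exp (-1) →
      |iteratedDeriv i (fun s => cutoff χ (q * pLog p (s * e)) A) t| ≤ C * t ^ (-(i : ℤ)))
    (hΔ : Δ.PosDef) {m : ℝ} (hm : 0 < m) (hΔm : ∀ φ : α → ℝ, m * (φ ⬝ᵥ φ) ≤ φ ⬝ᵥ (Δ *ᵥ φ))
    (hχ : ∀ x, 0 ≤ χ.χ₁ x) {c₀ : ℝ} (hc₀ : 0 < c₀) (hcb : ∀ b ∈ B, c₀ ≤ c b) {Λ : ℝ} (hΛ : 0 < Λ)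
    (hmod : ∀ b ∈ B, ∃ ℓ₁ ℓ₂ : (α → ℝ) → ℝ, IsLinearMap ℝ ℓ₁ ∧ IsLinearMap ℝ ℓ₂ ∧
      ((∀ φ, Φ b φ = ℓ₁ φ) ∨ (∀ φ, Φ b φ = Real.sqrt (ℓ₁ φ ^ 2 + ℓ₂ φ ^ 2))) ∧
      (∀ φ, |ℓ₁ φ| ≤ Λ * Real.sqrt (φ ⬝ᵥ φ)) ∧ (∀ φ, |ℓ₂ φ| ≤ Λ * Real.sqrt (φ ⬝ᵥ φ)))
    {F : ℝ} (hF0 : 0 ≤ F) (hF : ∀ i : I, src blk ℱ {i} ⬝ᵥ src blk ℱ {i} ≤ F ^ 2)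
    (hV : ∀ Y ∈ Ys, Measurable (V Y)) {KY : υ → ℝ} (hK : ∀ Y ∈ Ys, ∀ φ, |V Y φ| ≤ KY Y)
    {K₁ : ℝ} (hK₁0 : 0 ≤ K₁) (hK₁ : ∀ Y ∈ Ys, KY Y ≤ K₁) {G : ℕ} (hG : ∀ i, (univ.filter fun τ : ↥B ⊕ ↥Ys => cube τ = i).card ≤ G)
    (hek : 0 < ek) (hek1 : ek ≤ Real.exp (-1)) {θ β' : ℝ} (hθ0 : 0 < θ) (hθ1 : θ ≤ 1) (hβ : 0 ≤ β')
    (hreg₂ : (n₀ : ℝ) + 2 ≤ m / (8 * Λ ^ 2) * (81 / 100) * c₀ ^ 2 * Real.log ek⁻¹ ^ (2 * p - 1))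
    (hpre₂ : C ^ n₀ * (4 * Real.exp (F ^ 2 / m)) * Real.exp (2 * G * K₁) * ek ≤ 1)
    (hvac₂ : Real.exp (2 * G * K₁) * (2 * G) * (4 * Real.exp (F ^ 2 / m)) * ek + (Real.exp (2 * G * K₁) - 1) ≤ θ ^ (2 * β') / 2)
    (hekθ : ek ≤ θ) (hχβ : 2 * ek ≤ θ ^ β') (hKθ₂ : ∀ Y ∈ Ys, KY Y * Real.exp (2 * G * K₁) ≤ θ ^ (1 + β') / 2)
    (Λc X : Finset I) {t : ℝ} (ht : t ∈ Set.Ioc (0 : ℝ) 1) {L : Type} [Fintype L] [DecidableEq L] (hL : Fintype.card L ≤ n₀)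
    (γ : L → ↥(slotB B Ys cube X) ⊕ ↥(slotY B Ys cube X))
    (h3 : ∀ (H : Finset L) (X₃ : Finset I), 3 ≤ X₃.card →
      |locAct (cubeIn cube X ∘ γ) (actIn blk Δ ℱ adj χ p ek B Φ c Ys V cube Λc X t γ) H X₃| ≤
        θ ^ ((H.card : ℝ) + β' * ((X₃ \ H.image (cubeIn cube X ∘ γ)).card : ℝ)))
    (H : Finset L) (X'' : Finset I) (h2 : 2 ≤ X''.card) :
    |locAct (cubeIn cube X ∘ γ) (actIn blk Δ ℱ adj χ p ek B Φ c Ys V cube Λc X t γ) H X''| ≤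
      θ ^ ((H.card : ℝ) + β' * ((X'' \ H.image (cubeIn cube X ∘ γ)).card : ℝ)) := by
  by_cases h : X''.card = 2
  · exact ineq5144_locAct_pair_of_struct_chi blk Δ ℱ adj χ cube hp hC1 hC hΔ hm hΔm hχ hc₀ hcb hΛ hmod hF0 hF hV hK hK₁0 hK₁ hG hek hek1
      hθ0 hθ1 hβ hreg₂ hpre₂ hvac₂ hekθ hχβ hKθ₂ Λc X ht hL γ H X'' h
  · exact h3 H X'' (by omega)

end TwoCube

end Literature.MathematicalPhysics.QuantumFieldTheory.BalabanImbrieJaffe1984to88.BIJ88Ineq5144TwoCubeChi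

end
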